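import Mathlib.MeasureTheory.Integral.Bochner.Basic
import Summits.CriticalPhenomena.CardyFormulaZ2.Theorems.CardyFlipRussoQuadrupoleSelectionRuleCyclicAverage

/-!
# Isotropic cancellation, measure form: an invariant law kills every observable of nontrivial weight

Helper file for the crux `QuadrupoleSelectionRule` (stmt-CriticalPhenomena-7029, informal), route
`CardyFlipRusso`, sub-problem `CardyFormulaZ2`, line `Sketch` generation 2 ("TransferR2"),
stub T4 "isotropic cancellation, measure form".

If a measure `μ` on `X` is invariant under a measurable map `g` (`g_* μ = μ`) and an observable
`F : X → ℂ` transforms under `g` with a weight `ω ≠ 1` (`F ∘ g = ω • F`), then `∫ F dμ = 0`: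

`∫ F dμ = ∫ F d(g_* μ) = ∫ F ∘ g dμ = ω ∫ F dμ`, hence `(1 - ω) ∫ F dμ = 0`.

No integrability hypothesis is needed: the change of variables `integral_map` and the linearity
`integral_const_mul` hold for the Bochner integral unconditionally (both sides vanish when `F` is
not integrable).

This is the measure-theoretic form of the symmetry half of the selection rule: under a rotation
symmetry of order `m` of the law, every far-field channel of spin `s ∉ mℤ` has weight
`ω = e^{2πi s/m} ≠ 1` (`exp_two_pi_mul_spin_div_ne_one`) and therefore integrates to zero
(`integral_eq_zero_of_map_eq_of_spin_not_dvd`); the finite-sum form is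
`sum_exp_spin_rotate_eq_zero` in `CardyFlipRussoQuadrupoleSelectionRuleCyclicAverage.lean`.
We also record the real-valued version (weight `c ≠ 1`, in particular odd observables `c = -1`
under an involutive role shift).

All statements are elementary measure theory (`integral_map`, `integral_const_mul`, `mul_eq_zero`).
-/

noncomputable section

open MeasureTheory

namespace Summit.CriticalPhenomena.CardyFormulaZ2.Theorems

/-- **Isotropic cancellation, measure form** (stub T4 of line `Sketch`, generation 2, for the crux
`QuadrupoleSelectionRule`).  If `μ` is `g`-invariant and the complex observable `F` has `g`-weight
`ω ≠ 1`, i.e. `F (g x) = ω * F x` for all `x`, then `∫ F dμ = 0`.  No integrability hypothesis is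
needed. [folklore] -/
theorem integral_eq_zero_of_map_eq_of_comp_eq_mul {X : Type*} [MeasurableSpace X] (μ : Measure X)
    (g : X → X) (hg : Measurable g) (hμ : μ.map g = μ) (F : X → ℂ) (hF : Measurable F) (ω : ℂ)
    (hω : ω ≠ 1) (hFg : ∀ x, F (g x) = ω * F x) :
    ∫ x, F x ∂μ = 0 := by
  -- `∫ F dμ = ∫ F d(g_* μ) = ∫ F ∘ g dμ = ∫ ω F dμ = ω ∫ F dμ`.
  have h1 : ∫ x, F x ∂μ = ω * ∫ x, F x ∂μ := by
    calc ∫ x, F x ∂μ = ∫ x, F x ∂(μ.map g) := by rw [hμ]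
      _ = ∫ x, F (g x) ∂μ := integral_map hg.aemeasurable hF.aestronglyMeasurable
      _ = ∫ x, ω * F x ∂μ := by simp only [hFg]
      _ = ω * ∫ x, F x ∂μ := integral_const_mul ω F
  -- Hence `(1 - ω) ∫ F dμ = 0` with `1 - ω ≠ 0`.
  have h2 : (1 - ω) * ∫ x, F x ∂μ = 0 := by rw [sub_mul, one_mul, ← h1, sub_self]
  exact (mul_eq_zero.mp h2).resolve_left (sub_ne_zero.mpr hω.symm)

/-- **Isotropic cancellation, real-valued observables.**  If `μ` is `g`-invariant and the real
observable `h` has `g`-weight `c ≠ 1`, i.e. `h (g x) = c * h x` for all `x`, then `∫ h dμ = 0`.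
No integrability hypothesis is needed. [folklore] -/
theorem integral_eq_zero_of_map_eq_of_comp_eq_mul_real {X : Type*} [MeasurableSpace X]
    (μ : Measure X) (g : X → X) (hg : Measurable g) (hμ : μ.map g = μ) (h : X → ℝ)
    (hh : Measurable h) (c : ℝ) (hc : c ≠ 1) (hhg : ∀ x, h (g x) = c * h x) :
    ∫ x, h x ∂μ = 0 := by
  have h1 : ∫ x, h x ∂μ = c * ∫ x, h x ∂μ := by
    calc ∫ x, h x ∂μ = ∫ x, h x ∂(μ.map g) := by rw [hμ]
      _ = ∫ x, h (g x) ∂μ := integral_map hg.aemeasurable hh.aestronglyMeasurable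
      _ = ∫ x, c * h x ∂μ := by simp only [hhg]
      _ = c * ∫ x, h x ∂μ := integral_const_mul c h
  have h2 : (1 - c) * ∫ x, h x ∂μ = 0 := by rw [sub_mul, one_mul, ← h1, sub_self]
  exact (mul_eq_zero.mp h2).resolve_left (sub_ne_zero.mpr hc.symm)

/-- **Odd observables integrate to zero against an invariant law.**  If `μ` is `g`-invariant and
`h` is `g`-odd (`h (g x) = - h x`, e.g. the `σ`-odd part `h - h ∘ σ` of an observable under an
involutive role shift `σ`), then `∫ h dμ = 0`. [folklore] -/
theorem integral_eq_zero_of_map_eq_of_comp_eq_neg {X : Type*} [MeasurableSpace X]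
    (μ : Measure X) (g : X → X) (hg : Measurable g) (hμ : μ.map g = μ) (h : X → ℝ)
    (hh : Measurable h) (hhg : ∀ x, h (g x) = -h x) :
    ∫ x, h x ∂μ = 0 :=
  integral_eq_zero_of_map_eq_of_comp_eq_mul_real μ g hg hμ h hh (-1) (by norm_num)
    fun x => by rw [hhg x, neg_one_mul]

/-- **Spin-`s` channels with `m ∤ s` vanish under a rotation symmetry of order `m`.**  If `μ` is
invariant under `g` (a rotation of order `m ≠ 0` of the law) and the complex observable `F` has
spin `s` under `g`, i.e. `F (g x) = e^{2πi s/m} F x`, with `m ∤ s`, then `∫ F dμ = 0`: the weight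
`e^{2πi s/m}` is `≠ 1` by `exp_two_pi_mul_spin_div_ne_one`.  In particular (`s = 2`, `m ≥ 3`) the
quadrupole channel of a `C_m`-invariant law with `m ≥ 3` integrates to zero. [folklore] -/
theorem integral_eq_zero_of_map_eq_of_spin_not_dvd {X : Type*} [MeasurableSpace X]
    (μ : Measure X) (g : X → X) (hg : Measurable g) (hμ : μ.map g = μ) (F : X → ℂ)
    (hF : Measurable F) {m : ℕ} {s : ℤ} (hm : m ≠ 0) (hs : ¬ (m : ℤ) ∣ s)
    (hFg : ∀ x, F (g x) = Complex.exp (2 * Real.pi * Complex.I * s / m) * F x) :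
    ∫ x, F x ∂μ = 0 :=
  integral_eq_zero_of_map_eq_of_comp_eq_mul μ g hg hμ F hF _
    (exp_two_pi_mul_spin_div_ne_one hm hs) hFg

end Summit.CriticalPhenomena.CardyFormulaZ2.Theorems

end
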